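import Literature.NumberTheory.GaloisRepresentations.IdeleClassCharacterPairingEmbedded
import HarnessLib

/-!
# The pairing `inv_{L/F}(ι[x] ∪ β_m[χ]) = −χ(γ|_L)/m` at EVERY finite Galois layer `L ⊆ F̄` (not only abelian ones),
# for every `ℤ/m`-character `χ` of `Gal(L/F)` and every `γ ∈ Γ_F` representing `θ[x]`
# (Tate, C–F VII §11.3, §5.4; Serre XI §3; Neukirch III §6)

Topic `NumberTheory/GaloisRepresentations`; namespace `Literature.NumberTheory.GaloisRepresentations.IdeleCohomology`
(sequel to `IdeleClassCharacterPairingEmbedded`).  Definitions with bodies (`characterLayer L χ ⊆ L`, the finite ABELIAN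
sub-layer of `F̄` cut out by `ker(χ ∘ res_L) ≤ Gal(F̄/F)` — infinite Galois theory, Mathlib `InfiniteGalois` — and its
character `characterLayerCharacter`) and theorems; NO named fact, no `sorry`, no instance, no notation; number fields in
`Type`.

Route A reads `H¹(Γ_F, ℤ/m)` as the union over the open normal `U ≤ Γ_F` of `Hom(Γ_F/U, ℤ/m)`, i.e. over ALL finite
Galois `L = F̄^U ⊆ F̄` of `Hom(Gal(L/F), ℤ/m)`; at such a layer the value of Milne's pairing is

* **`classInvAll_baseCup_bockstein_eq_absRestrictNormalHom_of_isGalois`**: for `L ⊆ F̄` finite GALOIS, `m ≥ 1`,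
  `χ : Gal(L/F) → ℤ/m`, an idèle `x` of `F` and any `γ ∈ Γ_F` with `γ̄ = θ[x] ∈ Γ_F^{ab}`:
  `inv_{L/F}(ι[x] ∪ β_m[χ]) = −χ(absRestrictNormalHom L γ)/m`.

Proof: `χ ∘ res_L : Γ_F → ℤ/m` has open normal kernel `H ⊇ Gal(F̄/L)`; its fixed field `K₀ = F̄^H ⊆ L`
(`characterLayer`) is finite abelian over `F` with `Gal(F̄/K₀) = H` (`InfiniteGalois.fixingSubgroup_fixedField`), `χ`
descends to `χ₀ : Gal(K₀/F) → ℤ/m` with `χ₀(γ|_{K₀}) = χ(γ|_L)` (`characterLayerCharacter_absRestrictNormalHom`), and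
`χ = χ₀ ∘ res^L_{K₀}`; then door-c6 g14's inflation invariance `inv_L(ι_L[x] ∪ β_m[χ₀ ∘ res]) = inv_{K₀}(ι_{K₀}[x] ∪ β_m[χ₀])`
(`classInvAll_baseCup_bockstein_comp`) and the embedded abelian case (`classInvAll_baseCup_bockstein_eq_absRestrictNormalHom`).

HONEST FRAMING: classical; no case of BSD / Poitou–Tate.  Written for Route A (A5) of crux `AnticycControlAdditiveK` (cell
bsd-schneider): the layer-by-layer value of `α¹(Γ_F, ℤ/m)` in the currency of door-c4's (d)-colimit (`Γ_F ⧸ U ≅ Gal(L/F)` via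
`absRestrictNormalHom L`).

## References
* J. W. S. Cassels, A. Fröhlich (eds.), *Algebraic Number Theory* (1967), Ch. VII (J. Tate) §11.3, §5.4. [CasselsFrohlichANT1967]
* J.-P. Serre, *Local Fields*, GTM 67 (1979), XI §3 Prop. 2, XIV §1. [SerreLocalFields1979]
* J. Neukirch, *Class Field Theory — The Bonn Lectures* (2013), Part III §6 (6.13)–(6.14). [Neukirch2013]
* J. S. Milne, *Arithmetic Duality Theorems*, 2nd ed. (2006), Ch. I Thm. 1.8 (b). [MilneADT2006]
-/

noncomputable section

set_option backward.isDefEq.respectTransparency false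

namespace Literature.NumberTheory.GaloisRepresentations

namespace IdeleCohomology

open CategoryTheory NumberField IsDedekindDomain groupCohomology Function Field
open Literature.NumberTheory.Automorphic
open Literature.Algebra.Homology Literature.Algebra.Homology.Bockstein IdeleClassGroup
open Literature.AnabelianGeometry.AbsoluteAnabelian.Prop121vii (zmodToQmodZ zmodToQmodZ_apply)

variable {F : Type} [Field F] [NumberField F]
variable (L : IntermediateField F (AlgebraicClosure F)) [FiniteDimensional F L] [IsGalois F L]
variable (m : ℕ) (χ : Additive (L ≃ₐ[F] L) →+ ZMod m)

/-! ## §1. The abelian sub-layer cut out by a character of a Galois layer -/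

/-- `ker(χ ∘ res_L) ≤ Gal(F̄/F)` (as a subgroup of `F̄ ≃ₐ[F] F̄`). [cite: Neukirch2013, Part III §6] -/
def characterKer : Subgroup (AlgebraicClosure F ≃ₐ[F] AlgebraicClosure F) :=
  ((AddMonoidHom.toMultiplicativeRight χ).comp (AlgEquiv.restrictNormalHom L)).ker

omit [NumberField F] [FiniteDimensional F L] in
/-- Membership: `σ ∈ ker(χ ∘ res_L) ↔ χ(σ|_L) = 0`. [cite: Neukirch2013, Part III §6] -/
theorem mem_characterKer_iff (σ : AlgebraicClosure F ≃ₐ[F] AlgebraicClosure F) :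
    σ ∈ characterKer L m χ ↔ χ (Additive.ofMul (AlgEquiv.restrictNormalHom L σ)) = 0 := by
  rw [characterKer, MonoidHom.mem_ker, MonoidHom.comp_apply, AddMonoidHom.toMultiplicativeRight_apply_apply]
  exact ⟨fun h => by simpa using congrArg Multiplicative.toAdd h, fun h => by rw [h]; rfl⟩

omit [NumberField F] [FiniteDimensional F L] in
/-- `Gal(F̄/L) ≤ ker(χ ∘ res_L)`. [cite: Neukirch2013, Part III §6] -/
theorem fixingSubgroup_le_characterKer : L.fixingSubgroup ≤ characterKer L m χ := by
  intro σ hσ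
  rw [← IntermediateField.restrictNormalHom_ker L, MonoidHom.mem_ker] at hσ
  rw [characterKer, MonoidHom.mem_ker, MonoidHom.comp_apply, hσ, map_one]

omit [NumberField F] in
/-- `ker(χ ∘ res_L)` is open. [cite: Neukirch2013, Part III §6] -/
theorem isOpen_characterKer : IsOpen (characterKer L m χ : Set (AlgebraicClosure F ≃ₐ[F] AlgebraicClosure F)) :=
  Subgroup.isOpen_mono (fixingSubgroup_le_characterKer L m χ) L.fixingSubgroup_isOpen

omit [NumberField F] in
/-- `ker(χ ∘ res_L)` is closed. [cite: Neukirch2013, Part III §6] -/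
theorem isClosed_characterKer :
    IsClosed (characterKer L m χ : Set (AlgebraicClosure F ≃ₐ[F] AlgebraicClosure F)) :=
  (characterKer L m χ).isClosed_of_isOpen (isOpen_characterKer L m χ)

/-- **The sub-layer `K₀ = F̄^{ker(χ ∘ res_L)}`** cut out by a `ℤ/m`-character of the Galois layer `L`.
[cite: Neukirch2013, Part III §6] -/
def characterLayer : IntermediateField F (AlgebraicClosure F) :=
  IntermediateField.fixedField (characterKer L m χ)

/-- `Gal(F̄/K₀) = ker(χ ∘ res_L)` (infinite Galois theory, closed subgroups). [cite: Neukirch2013, Part III §6] -/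
theorem fixingSubgroup_characterLayer : (characterLayer L m χ).fixingSubgroup = characterKer L m χ :=
  InfiniteGalois.fixingSubgroup_fixedField ⟨characterKer L m χ, isClosed_characterKer L m χ⟩

omit [FiniteDimensional F L] in
/-- `K₀ ≤ L`. [cite: Neukirch2013, Part III §6] -/
theorem characterLayer_le : characterLayer L m χ ≤ L := by
  intro x hx
  rw [← InfiniteGalois.fixedField_fixingSubgroup L]
  rw [characterLayer, IntermediateField.mem_fixedField_iff] at hx
  rw [IntermediateField.mem_fixedField_iff]
  exact fun σ hσ => hx σ (fixingSubgroup_le_characterKer L m χ hσ)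

/-- `K₀/F` is finite. [cite: Neukirch2013, Part III §6] -/
theorem finiteDimensional_characterLayer : FiniteDimensional F (characterLayer L m χ) := by
  rw [← InfiniteGalois.isOpen_iff_finite, fixingSubgroup_characterLayer]
  exact isOpen_characterKer L m χ

/-- `K₀/F` is Galois (`ker(χ ∘ res_L)` is normal). [cite: Neukirch2013, Part III §6] -/
theorem isGalois_characterLayer : IsGalois F (characterLayer L m χ) := by
  rw [← InfiniteGalois.normal_iff_isGalois, fixingSubgroup_characterLayer]
  exact MonoidHom.normal_ker _

/-- `γ|_{K₀} = 1 ↔ χ(γ|_L) = 0` for `γ ∈ Γ_F`. [cite: Neukirch2013, Part III §6] -/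
theorem absRestrictNormalHom_characterLayer_eq_one_iff (γ : absoluteGaloisGroup F) :
    haveI := isGalois_characterLayer L m χ
    absRestrictNormalHom (characterLayer L m χ) γ = 1 ↔ χ (Additive.ofMul (absRestrictNormalHom L γ)) = 0 := by
  haveI := isGalois_characterLayer L m χ
  rw [absRestrictNormalHom_eq_one_iff, fixingSubgroup_characterLayer, mem_characterKer_iff]
  rfl

/-- **`K₀/F` is ABELIAN**: `Gal(K₀/F) ≅ Γ_F/ker(χ ∘ res_L) ↪ ℤ/m`. [cite: Neukirch2013, Part III §6] -/
theorem isAbelianGalois_characterLayer : IsAbelianGalois F (characterLayer L m χ) := by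
  haveI := isGalois_characterLayer L m χ
  haveI : IsMulCommutative ((characterLayer L m χ) ≃ₐ[F] (characterLayer L m χ)) := by
    refine ⟨⟨fun a b => ?_⟩⟩
    obtain ⟨σ, rfl⟩ := absRestrictNormalHom_surjective (characterLayer L m χ) a
    obtain ⟨τ, rfl⟩ := absRestrictNormalHom_surjective (characterLayer L m χ) b
    rw [← commutatorElement_eq_one_iff_mul_comm, ← map_commutatorElement]
    refine (absRestrictNormalHom_characterLayer_eq_one_iff L m χ _).2 ?_
    rw [map_commutatorElement, commutatorElement_def, ofMul_mul, ofMul_mul, ofMul_mul, ofMul_inv, ofMul_inv, map_add,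
      map_add, map_add, map_neg, map_neg]
    abel
  exact ⟨⟩

/-! ## §2. The descended character `χ₀` of `Gal(K₀/F)` -/

/-- **The character `χ₀ : Gal(K₀/F) → ℤ/m` with `χ₀(γ|_{K₀}) = χ(γ|_L)`** (descent of `χ ∘ res_L` along the surjection
`Γ_F ↠ Gal(K₀/F)`, whose kernel is `ker(χ ∘ res_L)`). [cite: Neukirch2013, Part III §6] -/
def characterLayerCharacter : Additive ((characterLayer L m χ) ≃ₐ[F] (characterLayer L m χ)) →+ ZMod m :=
  haveI := isGalois_characterLayer L m χ
  MonoidHom.toAdditiveLeft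
    ((absRestrictNormalHom (characterLayer L m χ)).liftOfSurjective
      (absRestrictNormalHom_surjective (characterLayer L m χ))
      ⟨(AddMonoidHom.toMultiplicativeRight χ).comp (absRestrictNormalHom L), fun γ hγ => by
        rw [MonoidHom.mem_ker] at hγ ⊢
        rw [MonoidHom.comp_apply, AddMonoidHom.toMultiplicativeRight_apply_apply,
          (absRestrictNormalHom_characterLayer_eq_one_iff L m χ γ).1 hγ]
        rfl⟩)

/-- **`χ₀(γ|_{K₀}) = χ(γ|_L)`** for every `γ ∈ Γ_F`. [cite: Neukirch2013, Part III §6] -/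
theorem characterLayerCharacter_absRestrictNormalHom (γ : absoluteGaloisGroup F) :
    haveI := isGalois_characterLayer L m χ
    characterLayerCharacter L m χ (Additive.ofMul (absRestrictNormalHom (characterLayer L m χ) γ)) =
      χ (Additive.ofMul (absRestrictNormalHom L γ)) := by
  haveI := isGalois_characterLayer L m χ
  change Multiplicative.toAdd ((absRestrictNormalHom (characterLayer L m χ)).liftOfSurjective
      (absRestrictNormalHom_surjective (characterLayer L m χ)) _ (absRestrictNormalHom (characterLayer L m χ) γ)) = _
  rw [MonoidHom.liftOfRightInverse_comp_apply]
  rfl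

/-! ## §3. The pairing at every finite Galois layer -/

/-- **`inv_{L/F}(ι[x] ∪ β_m[χ]) = −χ(γ|_L)/m` at EVERY finite Galois layer `L ⊆ F̄`**, for every character
`χ : Gal(L/F) → ℤ/m`, every idèle `x` of `F` and every `γ ∈ Γ_F` representing the universal norm residue symbol `θ[x]`
(`γ|_L = absRestrictNormalHom L γ`).  Reduction to the abelian sub-layer `K₀ = F̄^{ker(χ ∘ res_L)}` by inflation
invariance of the pairing and the embedded abelian case.
[cite: CasselsFrohlichANT1967, Ch. VII §11.3, §5.4][cite: SerreLocalFields1979, Ch. XI §3 Prop. 2]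
[cite: MilneADT2006, Ch. I Thm. 1.8 (b)] -/
theorem classInvAll_baseCup_bockstein_eq_absRestrictNormalHom_of_isGalois [NumberField L] [NeZero m]
    (x : ideleGroup F) {γ : absoluteGaloisGroup F}
    (hγ : absGaloisAbProj F γ =
      (isCompatibleSystem_artinMapFamily (K := F) artinReciprocity_character_holds).theta (QuotientGroup.mk x)) :
    classInvAll F L (baseCup (E := L) x
        (δ (intModShortComplex_shortExact (L ≃ₐ[F] L) m) 1 2 rfl
          ((H1IsoOfIsTrivial (Rep.trivial ℤ (L ≃ₐ[F] L) (ZMod m))).inv χ))) =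
      -zmodToQmodZ m (χ (Additive.ofMul (absRestrictNormalHom L γ))) := by
  -- the abelian sub-layer `K₀ ⊆ L` and its structure
  haveI hfd := finiteDimensional_characterLayer L m χ
  haveI hab := isAbelianGalois_characterLayer L m χ
  haveI : IsGalois F (characterLayer L m χ) := isGalois_characterLayer L m χ
  haveI : NumberField (characterLayer L m χ) := NumberField.of_module_finite F _
  have hle : characterLayer L m χ ≤ L := characterLayer_le L m χ
  letI : Algebra (characterLayer L m χ) L := (IntermediateField.inclusion hle).toRingHom.toAlgebra
  haveI : IsScalarTower F (characterLayer L m χ) L := IsScalarTower.of_algebraMap_eq fun _ => rfl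
  haveI : IsScalarTower (characterLayer L m χ) L (AlgebraicClosure F) := IsScalarTower.of_algebraMap_eq fun _ => rfl
  -- `χ = χ₀ ∘ res^L_{K₀}`
  have hres : ∀ γ' : absoluteGaloisGroup F,
      AlgEquiv.restrictNormalHom (F := F) (K₁ := L) (characterLayer L m χ) (absRestrictNormalHom L γ') =
        absRestrictNormalHom (characterLayer L m χ) γ' := fun γ' =>
    (IsScalarTower.AlgEquiv.restrictNormalHom_comp_apply (characterLayer L m χ) L
      (absoluteGaloisGroup.toAlgEquiv F γ')).symm
  have hχ : χ = (characterLayerCharacter L m χ).comp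
      (MonoidHom.toAdditive (AlgEquiv.restrictNormalHom (F := F) (K₁ := L) (characterLayer L m χ))) := by
    refine AddMonoidHom.ext fun g => ?_
    obtain ⟨γ', hγ'⟩ := absRestrictNormalHom_surjective L (Additive.toMul g)
    rw [← ofMul_toMul g, ← hγ']
    change χ (Additive.ofMul (absRestrictNormalHom L γ')) =
      characterLayerCharacter L m χ (Additive.ofMul
        (AlgEquiv.restrictNormalHom (F := F) (K₁ := L) (characterLayer L m χ) (absRestrictNormalHom L γ')))
    rw [hres γ', characterLayerCharacter_absRestrictNormalHom]
  -- inflation invariance + the embedded abelian case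
  have key := classInvAll_baseCup_bockstein_comp F (characterLayer L m χ) L m (characterLayerCharacter L m χ) x
  rw [← hχ] at key
  rw [key, classInvAll_baseCup_bockstein_eq_absRestrictNormalHom (characterLayer L m χ) m
    (characterLayerCharacter L m χ) x hγ, characterLayerCharacter_absRestrictNormalHom]

/-- **Kernel form at every finite Galois layer**: `inv_{L/F}(ι[x] ∪ β_m[χ]) = 0 ↔ χ(γ|_L) = 0`.
[cite: CasselsFrohlichANT1967, Ch. VII §11.3, §5.1 Main Theorem (B)] -/
theorem classInvAll_baseCup_bockstein_eq_zero_iff_of_isGalois [NumberField L] [NeZero m]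
    (x : ideleGroup F) {γ : absoluteGaloisGroup F}
    (hγ : absGaloisAbProj F γ =
      (isCompatibleSystem_artinMapFamily (K := F) artinReciprocity_character_holds).theta (QuotientGroup.mk x)) :
    classInvAll F L (baseCup (E := L) x
        (δ (intModShortComplex_shortExact (L ≃ₐ[F] L) m) 1 2 rfl
          ((H1IsoOfIsTrivial (Rep.trivial ℤ (L ≃ₐ[F] L) (ZMod m))).inv χ))) = 0 ↔
      χ (Additive.ofMul (absRestrictNormalHom L γ)) = 0 := by
  rw [classInvAll_baseCup_bockstein_eq_absRestrictNormalHom_of_isGalois L m χ x hγ, neg_eq_zero,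
    ← map_zero (zmodToQmodZ m)]
  exact (Literature.AnabelianGeometry.AbsoluteAnabelian.Prop121vii.zmodToQmodZ_injective m).eq_iff

end IdeleCohomology

end Literature.NumberTheory.GaloisRepresentations

end
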